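import Literature.NumberTheory.Automorphic.HaarIntegralClosedCompactRadonSets
import Mathlib.Probability.Kernel.Composition.IntegralCompProd
import Mathlib.Probability.Kernel.Composition.MeasureComp
import HarnessLib

/-!
# Haar integral over `G = H K`: the `L¹` statement in the book's (Radon) generality

Topic `NumberTheory/Automorphic`; namespace `Literature.NumberTheory.Automorphic.HaarHK`.
Deitmar–Echterhoff, *Principles of Harmonic Analysis* (2014), Prop. 1.5.6, **proved** for every
locally compact Hausdorff group `G`, closed `H ≤ G`, compact `K ≤ G` with `G = HK`, and regular
(= outer Radon, the book's standing convention for Haar measures, Thm. 1.3.5) left Haar measures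
`μ_G`, `μ_H` and a Haar measure `μ_K`:

* `exists_pos_integral_eq_smul_integral_integral_of_regular`: there is `C > 0` with
  `∫_G f dμ_G = C • ∫_H ∫_K f(h k) dμ_K dμ_H` for every Bochner-integrable `f : G → E`;
* `DeitmarEchterhoff2014_prop156_of_regular`: the complex-valued form — literally the body of the
  named fact `DeitmarEchterhoff2014_prop156_radon` of `HaarIntegralClosedCompact.lean`, which it
  discharges there (`DeitmarEchterhoff2014_prop156_radon_holds`). The second-countable case, where
  regularity is automatic, was proved earlier in `HaarIntegralClosedCompactProofs.lean`
  (`HaarHK.integral_eq_mul_integral_integral_of_secondCountable`).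

Proof architecture (the book argues via uniqueness of `H × K`-invariant Radon measures on
`(H × K)/(H ∩ K)`, Thm. 1.5.3, and Radon products, none of which Mathlib has): the `C_c` identity
(`HaarIntegralClosedCompactCcGeneral.lean`, Riesz–Markov on `H`) and the set-level identity
`μ_G(A) = C ∫⁻_H μ_K{k : hk ∈ A} dμ_H` for Borel `A` of finite measure
(`HaarIntegralClosedCompactRadonSets.lean`, τ-smoothness); then, with the measurable kernel
`κ h = (h·)_* μ_K : H → Measure G` and `ν = κ ∘ₘ μ_H`, an integrable `f` is a.e. equal to a strongly
measurable `f'` supported on a σ-finite Borel set `T` on which `μ_G|_T = C ν|_T`; the Bochner–Fubini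
formula for `κ ∘ₘ μ_H` (`ProbabilityTheory.Kernel.integral_comp`, valid without any σ-finiteness)
turns `∫ f' dν` into `∫_H ∫_K f'(hk)`, and `μ_G`-null sets have `μ_H`-a.e. `μ_K`-null slices, which
transfers back to `f`.

## References

* A. Deitmar, S. Echterhoff, *Principles of Harmonic Analysis*, 2nd ed., Universitext, Springer
  (2014), §1.5, Prop. 1.5.6 (p. 21), Thm. 1.3.5 (p. 8). [DeitmarEchterhoff2014]
-/

noncomputable section

open MeasureTheory Measure Set Topology
open scoped ENNReal NNReal

namespace Literature.NumberTheory.Automorphic.HaarHK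

section RadonL1

open ProbabilityTheory

variable {G : Type*} [Group G] [TopologicalSpace G] [IsTopologicalGroup G] [MeasurableSpace G]
  [BorelSpace G] [T2Space G] [LocallyCompactSpace G] {H K : Subgroup G}

/-- **Deitmar–Echterhoff Prop. 1.5.6 — the general (Radon) case, Banach-space-valued integrands.**
For a locally compact Hausdorff group `G`, a closed subgroup `H`, a compact subgroup `K` with
`G = HK`, and *regular* (Radon) left Haar measures `μ_G`, `μ_H` and a Haar measure `μ_K`, there is
`C > 0` such that for every `f ∈ L¹(G, μ_G)`:
`∫_G f dμ_G = C • ∫_H ∫_K f(h k) dμ_K(k) dμ_H(h)` (Bochner integrals).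

Proof: with `κ h = (h ·)_* μ_K` (a measurable kernel `H → G` by
`measurable_measure_mul_preimage`) and `ν = κ ∘ₘ μ_H`, the `C_c` identity gives `ν = C⁻¹ μ_G` on
open sets (τ-smoothness of the Radon measure `μ_H`), hence on compact sets and on Borel sets of
finite `μ_G`-measure; an integrable `f` lives on a σ-finite Borel set `T`, where
`μ_G|_T = C ν|_T`; the Bochner–Fubini formula for `κ ∘ₘ μ_H` (`Kernel.integral_comp`, no
σ-finiteness needed) and the transfer of `μ_G`-null sets to `μ_H`-a.e. null slices finish the
proof. [cite: DeitmarEchterhoff2014, Prop. 1.5.6] -/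
theorem exists_pos_integral_eq_smul_integral_integral_of_regular (hH : IsClosed (H : Set G))
    (hK : IsCompact (K : Set G)) (hHK : ∀ g : G, ∃ h ∈ H, ∃ k ∈ K, g = h * k)
    (μG : Measure G) [IsHaarMeasure μG] [μG.Regular] (μH : Measure H) [IsHaarMeasure μH]
    [μH.Regular] (μK : Measure K) [IsHaarMeasure μK]
    (E : Type*) [NormedAddCommGroup E] [NormedSpace ℝ E] :
    ∃ C : ℝ, 0 < C ∧ ∀ f : G → E, Integrable f μG →
      ∫ g, f g ∂μG = C • ∫ h : H, ∫ k : K, f ((h : G) * k) ∂μK ∂μH := by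
  haveI : CompactSpace K := isCompact_iff_compactSpace.mp hK
  obtain ⟨C, hC0, hC⟩ :=
    exists_pos_integral_eq_mul_integral_integral_of_continuous hH hK hHK μG μH μK
  refine ⟨C, hC0, fun f hf => ?_⟩
  have hC0' : ENNReal.ofReal C ≠ 0 := by simpa using hC0
  have hm : ∀ h : H, Measurable fun k : K => (h : G) * (k : G) := fun h =>
    (continuous_coe_mul_coe h).measurable
  -- the kernel `h ↦ (h·)_* μ_K` and the measure `ν = κ ∘ₘ μ_H`
  let κ : Kernel H G := ⟨fun h => map (fun k : K => (h : G) * (k : G)) μK,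
    Measure.measurable_of_measurable_coe _ fun A hA => by
      have : (fun h : H => (map (fun k : K => (h : G) * (k : G)) μK) A) =
          fun h : H => μK ((fun k : K => (h : G) * k) ⁻¹' A) := by
        funext h; rw [map_apply (hm h) hA]
      rw [this]
      exact measurable_measure_mul_preimage μK hA⟩
  have hκ : ∀ h : H, κ h = map (fun k : K => (h : G) * (k : G)) μK := fun h => rfl
  set ν : Measure G := κ ∘ₘ μH with hν
  have hνA : ∀ A : Set G, MeasurableSet A →
      ν A = ∫⁻ h, μK ((fun k : K => (h : G) * k) ⁻¹' A) ∂μH := by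
    intro A hA
    rw [hν, Measure.bind_apply hA κ.aemeasurable]
    simp_rw [hκ, map_apply (hm _) hA]
  -- a strongly measurable version of `f` and its σ-finite support
  set f' : G → E := hf.1.mk f with hf'def
  have hf'm : StronglyMeasurable f' := hf.1.stronglyMeasurable_mk
  have hff' : f =ᵐ[μG] f' := hf.1.ae_eq_mk
  have hf'i : Integrable f' μG := hf.congr hff'
  let S : ℕ → Set G := fun n => {x | 1 / ((n : ℝ) + 1) ≤ ‖f' x‖}
  have hSm : ∀ n, MeasurableSet (S n) := fun n =>
    measurableSet_le measurable_const hf'm.norm.measurable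
  have hSfin : ∀ n, μG (S n) ≠ ∞ := fun n => (hf'i.measure_norm_ge_lt_top (by positivity)).ne
  have hSmono : Monotone S := by
    intro m n hmn x hx
    have h1 : 1 / ((n : ℝ) + 1) ≤ 1 / ((m : ℝ) + 1) :=
      one_div_le_one_div_of_le (by positivity) (by exact_mod_cast Nat.add_le_add_right hmn 1)
    exact h1.trans hx
  set T : Set G := ⋃ n, S n with hT
  have hsupp : Function.support f' ⊆ T := by
    intro x hx
    obtain ⟨n, hn⟩ := exists_nat_one_div_lt (norm_pos_iff.mpr hx)
    exact mem_iUnion.mpr ⟨n, hn.le⟩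
  have hf'T : ∀ x, x ∉ T → f' x = 0 := fun x hx =>
    Function.notMem_support.mp fun h => hx (hsupp h)
  -- `μ_G|_T = C • ν|_T`
  have hrestr : μG.restrict T = ENNReal.ofReal C • ν.restrict T := by
    ext B hB
    rw [Measure.smul_apply, Measure.restrict_apply hB, Measure.restrict_apply hB, smul_eq_mul]
    have hmono : Monotone fun n => B ∩ S n := fun m n hmn => inter_subset_inter_right B (hSmono hmn)
    rw [hT, inter_iUnion, hmono.measure_iUnion, hmono.measure_iUnion, ENNReal.mul_iSup]
    congr 1 with n
    rw [hνA _ (hB.inter (hSm n))]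
    exact measure_eq_mul_lintegral_measure_mul_preimage hH hK μG μH μK hC0 hC (hB.inter (hSm n))
      (ne_top_of_le_ne_top (hSfin n) (measure_mono inter_subset_right))
  -- integrability of `f'` for `ν`
  have hf'ν : Integrable f' ν := by
    have h1 : IntegrableOn f' T μG := hf'i.integrableOn
    rw [IntegrableOn, hrestr, integrable_smul_measure hC0' ENNReal.ofReal_ne_top] at h1
    exact (integrableOn_iff_integrable_of_support_subset hsupp).mp h1
  -- `μ_G`-null sets have `μ_H`-a.e. null slices
  obtain ⟨N, hNsub, hNm, hN0⟩ := exists_measurable_superset_of_null (ae_iff.mp hff')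
  have haeN : ∀ᵐ (h : H) ∂μH, μK ((fun k : K => (h : G) * k) ⁻¹' N) = 0 := by
    have h0 := measure_eq_mul_lintegral_measure_mul_preimage hH hK μG μH μK hC0 hC hNm
      (by rw [hN0]; exact ENNReal.zero_ne_top)
    rw [hN0, eq_comm, mul_eq_zero] at h0
    exact (lintegral_eq_zero_iff (measurable_measure_mul_preimage μK hNm)).mp
      (h0.resolve_left hC0')
  -- the computation
  have hcomp : ν = (κ ∘ₖ Kernel.const Unit μH) () := Measure.comp_eq_comp_const_apply
  calc ∫ g, f g ∂μG = ∫ g, f' g ∂μG := integral_congr_ae hff'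
    _ = ∫ g in T, f' g ∂μG := (setIntegral_eq_integral_of_forall_compl_eq_zero
        fun x hx => hf'T x hx).symm
    _ = C • ∫ g in T, f' g ∂ν := by
        rw [show μG.restrict T = ENNReal.ofReal C • ν.restrict T from hrestr,
          integral_smul_measure, ENNReal.toReal_ofReal hC0.le]
    _ = C • ∫ g, f' g ∂ν := by
        rw [setIntegral_eq_integral_of_forall_compl_eq_zero fun x hx => hf'T x hx]
    _ = C • ∫ h : H, ∫ g, f' g ∂(κ h) ∂μH := by
        rw [hcomp, Kernel.integral_comp (by rwa [← hcomp]), Kernel.const_apply]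
    _ = C • ∫ h : H, ∫ k : K, f' ((h : G) * k) ∂μK ∂μH := by
        congr 1
        refine integral_congr_ae (ae_of_all _ fun h => ?_)
        simp only [hκ]
        rw [integral_map (hm h).aemeasurable hf'm.aestronglyMeasurable]
    _ = C • ∫ h : H, ∫ k : K, f ((h : G) * k) ∂μK ∂μH := by
        congr 1
        refine integral_congr_ae ?_
        filter_upwards [haeN] with h hh
        refine integral_congr_ae ?_
        filter_upwards [measure_eq_zero_iff_ae_notMem.mp hh] with k hk
        by_contra hne
        exact hk (hNsub fun heq => hne heq.symm)

/-- **Deitmar–Echterhoff Prop. 1.5.6 — general Radon case, complex integrands**: literally the body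
of the named fact `DeitmarEchterhoff2014_prop156_radon` (`HaarIntegralClosedCompact.lean`), for
which it supplies `DeitmarEchterhoff2014_prop156_radon_holds`. For `G` locally compact Hausdorff,
`H` closed, `K` compact, `G = HK`, regular left Haar measures `μ_G, μ_H` and a Haar measure `μ_K`,
there is `c > 0` with `∫_G f dμ_G = c ∫_H ∫_K f(hk) dμ_K dμ_H` for every `f ∈ L¹(G, μ_G)`.
[cite: DeitmarEchterhoff2014, Prop. 1.5.6] -/
theorem DeitmarEchterhoff2014_prop156_of_regular (hH : IsClosed (H : Set G))
    (hK : IsCompact (K : Set G)) (hHK : ∀ g : G, ∃ h ∈ H, ∃ k ∈ K, g = h * k)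
    (μG : Measure G) [IsHaarMeasure μG] [μG.Regular] (μH : Measure H) [IsHaarMeasure μH]
    [μH.Regular] (μK : Measure K) [IsHaarMeasure μK] :
    ∃ c : ℝ, 0 < c ∧ ∀ f : G → ℂ, Integrable f μG →
      ∫ g, f g ∂μG = c * ∫ h, ∫ k, f ((h : G) * (k : G)) ∂μK ∂μH := by
  obtain ⟨C, hC, h⟩ :=
    exists_pos_integral_eq_smul_integral_integral_of_regular hH hK hHK μG μH μK ℂ
  exact ⟨C, hC, fun f hf => by rw [h f hf, Complex.real_smul]⟩

end RadonL1

end Literature.NumberTheory.Automorphic.HaarHK
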